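import Mathlib

/-!
# Gap products of four consecutive integers (arithmetic core of the RATIO-TWO FACE LAW of the α register)

Pure arithmetic, used by `…TridiagonalRealStaticRatioTwoLaw.lean` (this lineage's ENS / face-rule lane on the static symmetric tridiagonal
register of `WeakLifting`, stmt-ValiantsHypothesis-19561):

* `prod_Icc_ratio` — the telescoping identity `∏_{j=1}^{N} (j+1)(j+2)/(j(j+3)) = 3(N+1)/(N+3)`;
* `prod_ratio_lt_three` — for a finite set `S` of positive integers, `∏_{j∈S} (j+1)(j+2) < 3 · ∏_{j∈S} j(j+3)`;
* **`gapProduct_consecutive_four`** — for an injective integer labelling `z` of a finite set containing four members with CONSECUTIVE values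
  `c, c+1, c+2, c+3`, the gap products `W_P = ∏_{Q ≠ P} |z_P − z_Q|` satisfy `W_{c+1} · W_{c+2} < W_c · W_{c+3}`: every other member sits at an
  integer offset `j ≥ 1` beyond one of the extremes and contributes `(j+1)(j+2)` to the middles against `j(j+3)` to the extremes, the four
  themselves contribute `4` against `36`, and each side telescopes below `3`.

This is exactly the negation of the ENS face inequality (`faceRule_of_sharp`: middles dominate) for a face whose four matching slope-sums are
consecutive integers with no other sum inside their span.  HONEST FRAMING: elementary arithmetic; nothing here is about pencils, `WeakLifting`,
Conjecture B, `MatrixDescartes` (18050) or `VP ≠ VNP`.  Seat: prover val-sym-lift-p2 g18, `--supports stmt-ValiantsHypothesis-19561`.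
-/

set_option linter.dupNamespace false
set_option autoImplicit false

namespace Summit.ValiantsHypothesis.ValiantsHypothesis.Theorems.KPlusLogSqLaw

namespace EdgeNormalForm

open Finset

/-! ## 1. Arithmetic: the external offsets telescope -/

/-- `∏_{j=1}^{N} (j+1)(j+2)/(j(j+3)) = 3(N+1)/(N+3)`. [folklore] -/
theorem prod_Icc_ratio (N : ℕ) :
    ∏ j ∈ Icc 1 N, (((j : ℝ) + 1) * ((j : ℝ) + 2)) / ((j : ℝ) * ((j : ℝ) + 3)) = 3 * ((N : ℝ) + 1) / ((N : ℝ) + 3) := by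
  induction N with
  | zero => norm_num
  | succ N ih =>
    rw [Finset.prod_Icc_succ_top (by omega), ih]
    push_cast
    field_simp
    ring

/-- for a finite set `S` of POSITIVE integers, `∏_{j∈S} (j+1)(j+2) < 3 · ∏_{j∈S} j(j+3)`. [folklore] -/
theorem prod_ratio_lt_three (S : Finset ℕ) (hS : ∀ j ∈ S, 1 ≤ j) :
    ∏ j ∈ S, (((j : ℝ) + 1) * ((j : ℝ) + 2)) < 3 * ∏ j ∈ S, ((j : ℝ) * ((j : ℝ) + 3)) := by
  have hpos : 0 < ∏ j ∈ S, ((j : ℝ) * ((j : ℝ) + 3)) :=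
    Finset.prod_pos fun j hj => mul_pos (by exact_mod_cast hS j hj) (by positivity)
  rcases S.eq_empty_or_nonempty with rfl | hne
  · norm_num
  set N := S.max' hne with hN
  have hsub : S ⊆ Icc 1 N := fun j hj => Finset.mem_Icc.mpr ⟨hS j hj, S.le_max' j hj⟩
  have hR : ∏ j ∈ S, (((j : ℝ) + 1) * ((j : ℝ) + 2)) / ((j : ℝ) * ((j : ℝ) + 3)) ≤ 3 * ((N : ℝ) + 1) / ((N : ℝ) + 3) := by
    rw [← prod_Icc_ratio N]
    have hext : ∏ j ∈ S, (((j : ℝ) + 1) * ((j : ℝ) + 2)) / ((j : ℝ) * ((j : ℝ) + 3)) =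
        ∏ j ∈ Icc 1 N, (if j ∈ S then (((j : ℝ) + 1) * ((j : ℝ) + 2)) / ((j : ℝ) * ((j : ℝ) + 3)) else 1) := by
      rw [Finset.prod_ite_mem, Finset.inter_eq_right.mpr hsub]
    rw [hext]
    refine Finset.prod_le_prod (fun j _ => ?_) (fun j hj => ?_)
    · split_ifs <;> positivity
    · have hj1 : (1 : ℝ) ≤ j := by exact_mod_cast (Finset.mem_Icc.mp hj).1
      split_ifs
      · exact le_rfl
      · rw [le_div_iff₀ (by positivity)]
        nlinarith
  have hsplit : ∏ j ∈ S, (((j : ℝ) + 1) * ((j : ℝ) + 2)) =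
      (∏ j ∈ S, (((j : ℝ) + 1) * ((j : ℝ) + 2)) / ((j : ℝ) * ((j : ℝ) + 3))) * ∏ j ∈ S, ((j : ℝ) * ((j : ℝ) + 3)) := by
    rw [← Finset.prod_mul_distrib]
    refine Finset.prod_congr rfl fun j hj => ?_
    have : (j : ℝ) * ((j : ℝ) + 3) ≠ 0 := ne_of_gt (mul_pos (by exact_mod_cast hS j hj) (by positivity))
    rw [div_mul_cancel₀ _ this]
  have hlt : 3 * ((N : ℝ) + 1) / ((N : ℝ) + 3) < 3 := by
    rw [div_lt_iff₀ (by positivity)]; nlinarith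
  rw [hsplit]
  exact (mul_le_mul_of_nonneg_right hR hpos.le).trans_lt (mul_lt_mul_of_pos_right hlt hpos)

/-! ## 2. The abstract gap-product lemma: four consecutive integers among distinct integers -/

/-- **Four consecutive integers beat the face rule.**  For an injective integer labelling `z` of a finite set `Act` containing four members with
the consecutive values `c, c+1, c+2, c+3`, the gap products `W_P = ∏_{Q ≠ P} |z_P − z_Q|` satisfy `W_{c+1} · W_{c+2} < W_c · W_{c+3}` (every
other member sits at an offset `j ≥ 1` beyond an extreme and contributes `(j+1)(j+2)` vs `j(j+3)`; the sides telescope below `3 · 3 = 9 = 36/4`).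
[this work] -/
theorem gapProduct_consecutive_four {ι : Type*} [DecidableEq ι] (Act : Finset ι) (z : ι → ℤ)
    (hinj : ∀ P ∈ Act, ∀ Q ∈ Act, z P = z Q → P = Q) (c : ℤ) {E₁ M₁ M₂ E₂ : ι}
    (hE₁ : E₁ ∈ Act) (hM₁ : M₁ ∈ Act) (hM₂ : M₂ ∈ Act) (hE₂ : E₂ ∈ Act)
    (zE₁ : z E₁ = c) (zM₁ : z M₁ = c + 1) (zM₂ : z M₂ = c + 2) (zE₂ : z E₂ = c + 3) :
    (∏ Q ∈ Act.erase M₁, |((z M₁ : ℝ)) - z Q|) * (∏ Q ∈ Act.erase M₂, |((z M₂ : ℝ)) - z Q|) <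
      (∏ Q ∈ Act.erase E₁, |((z E₁ : ℝ)) - z Q|) * (∏ Q ∈ Act.erase E₂, |((z E₂ : ℝ)) - z Q|) := by
  -- the four are pairwise distinct
  have hne : E₁ ≠ M₁ ∧ E₁ ≠ M₂ ∧ E₁ ≠ E₂ ∧ M₁ ≠ M₂ ∧ M₁ ≠ E₂ ∧ M₂ ≠ E₂ := by
    refine ⟨?_, ?_, ?_, ?_, ?_, ?_⟩ <;> intro h <;> have := congrArg z h <;> omega
  obtain ⟨h11, h12, h1e, hmm, h1E, h2E⟩ := hne
  -- externals
  set Ext : Finset ι := (((Act.erase E₁).erase M₁).erase M₂).erase E₂ with hExt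
  have hExt_mem : ∀ Q, Q ∈ Ext ↔ Q ∈ Act ∧ Q ≠ E₁ ∧ Q ≠ M₁ ∧ Q ≠ M₂ ∧ Q ≠ E₂ := by
    intro Q; simp only [hExt, Finset.mem_erase]; tauto
  -- every external value lies outside `[c, c+3]`
  have hout : ∀ Q ∈ Ext, z Q < c ∨ c + 3 < z Q := by
    intro Q hQ
    obtain ⟨hQA, hQ1, hQ2, hQ3, hQ4⟩ := (hExt_mem Q).mp hQ
    by_contra h
    rw [not_or, not_lt, not_lt] at h
    obtain ⟨h1, h2⟩ := h
    have : z Q = c ∨ z Q = c + 1 ∨ z Q = c + 2 ∨ z Q = c + 3 := by omega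
    rcases this with h | h | h | h
    · exact hQ1 (hinj Q hQA E₁ hE₁ (h.trans zE₁.symm))
    · exact hQ2 (hinj Q hQA M₁ hM₁ (h.trans zM₁.symm))
    · exact hQ3 (hinj Q hQA M₂ hM₂ (h.trans zM₂.symm))
    · exact hQ4 (hinj Q hQA E₂ hE₂ (h.trans zE₂.symm))
  -- decompositions `Act.erase P = {the other three} ∪ Ext`
  have hdecE₁ : Act.erase E₁ = insert M₁ (insert M₂ (insert E₂ Ext)) := by
    ext Q; simp only [Finset.mem_erase, Finset.mem_insert, hExt_mem]
    constructor
    · rintro ⟨hQ, hQA⟩; by_cases a1 : Q = M₁; · exact Or.inl a1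
      by_cases a2 : Q = M₂; · exact Or.inr (Or.inl a2)
      by_cases a3 : Q = E₂; · exact Or.inr (Or.inr (Or.inl a3))
      exact Or.inr (Or.inr (Or.inr ⟨hQA, hQ, a1, a2, a3⟩))
    · rintro (rfl | rfl | rfl | ⟨hQA, hQ, -, -, -⟩)
      · exact ⟨fun h => h11 h.symm, hM₁⟩
      · exact ⟨fun h => h12 h.symm, hM₂⟩
      · exact ⟨fun h => h1e h.symm, hE₂⟩
      · exact ⟨hQ, hQA⟩
  have hdecM₁ : Act.erase M₁ = insert E₁ (insert M₂ (insert E₂ Ext)) := by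
    ext Q; simp only [Finset.mem_erase, Finset.mem_insert, hExt_mem]
    constructor
    · rintro ⟨hQ, hQA⟩; by_cases a1 : Q = E₁; · exact Or.inl a1
      by_cases a2 : Q = M₂; · exact Or.inr (Or.inl a2)
      by_cases a3 : Q = E₂; · exact Or.inr (Or.inr (Or.inl a3))
      exact Or.inr (Or.inr (Or.inr ⟨hQA, a1, hQ, a2, a3⟩))
    · rintro (rfl | rfl | rfl | ⟨hQA, -, hQ, -, -⟩)
      · exact ⟨h11, hE₁⟩
      · exact ⟨fun h => hmm h.symm, hM₂⟩
      · exact ⟨fun h => h1E h.symm, hE₂⟩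
      · exact ⟨hQ, hQA⟩
  have hdecM₂ : Act.erase M₂ = insert E₁ (insert M₁ (insert E₂ Ext)) := by
    ext Q; simp only [Finset.mem_erase, Finset.mem_insert, hExt_mem]
    constructor
    · rintro ⟨hQ, hQA⟩; by_cases a1 : Q = E₁; · exact Or.inl a1
      by_cases a2 : Q = M₁; · exact Or.inr (Or.inl a2)
      by_cases a3 : Q = E₂; · exact Or.inr (Or.inr (Or.inl a3))
      exact Or.inr (Or.inr (Or.inr ⟨hQA, a1, a2, hQ, a3⟩))
    · rintro (rfl | rfl | rfl | ⟨hQA, -, -, hQ, -⟩)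
      · exact ⟨h12, hE₁⟩
      · exact ⟨hmm, hM₁⟩
      · exact ⟨fun h => h2E h.symm, hE₂⟩
      · exact ⟨hQ, hQA⟩
  have hdecE₂ : Act.erase E₂ = insert E₁ (insert M₁ (insert M₂ Ext)) := by
    ext Q; simp only [Finset.mem_erase, Finset.mem_insert, hExt_mem]
    constructor
    · rintro ⟨hQ, hQA⟩; by_cases a1 : Q = E₁; · exact Or.inl a1
      by_cases a2 : Q = M₁; · exact Or.inr (Or.inl a2)
      by_cases a3 : Q = M₂; · exact Or.inr (Or.inr (Or.inl a3))
      exact Or.inr (Or.inr (Or.inr ⟨hQA, a1, a2, a3, hQ⟩))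
    · rintro (rfl | rfl | rfl | ⟨hQA, -, -, -, hQ⟩)
      · exact ⟨h1e, hE₁⟩
      · exact ⟨h1E, hM₁⟩
      · exact ⟨h2E, hM₂⟩
      · exact ⟨hQ, hQA⟩
  have nE : E₁ ∉ Ext ∧ M₁ ∉ Ext ∧ M₂ ∉ Ext ∧ E₂ ∉ Ext := by
    refine ⟨?_, ?_, ?_, ?_⟩ <;> rw [hExt_mem] <;> tauto
  obtain ⟨nE₁, nM₁, nM₂, nE₂⟩ := nE
  -- expand the four gap products
  have i1 : M₁ ∉ insert M₂ (insert E₂ Ext) := by simp only [Finset.mem_insert, not_or]; exact ⟨hmm, h1E, nM₁⟩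
  have i2 : M₂ ∉ insert E₂ Ext := by simp only [Finset.mem_insert, not_or]; exact ⟨h2E, nM₂⟩
  have i3 : E₁ ∉ insert M₂ (insert E₂ Ext) := by simp only [Finset.mem_insert, not_or]; exact ⟨h12, h1e, nE₁⟩
  have i4 : E₁ ∉ insert M₁ (insert E₂ Ext) := by simp only [Finset.mem_insert, not_or]; exact ⟨h11, h1e, nE₁⟩
  have i5 : M₁ ∉ insert E₂ Ext := by simp only [Finset.mem_insert, not_or]; exact ⟨h1E, nM₁⟩
  have i6 : E₁ ∉ insert M₁ (insert M₂ Ext) := by simp only [Finset.mem_insert, not_or]; exact ⟨h11, h12, nE₁⟩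
  have i7 : M₁ ∉ insert M₂ Ext := by simp only [Finset.mem_insert, not_or]; exact ⟨hmm, nM₁⟩
  rw [hdecE₁, hdecM₁, hdecM₂, hdecE₂]
  simp only [Finset.prod_insert i1, Finset.prod_insert i2, Finset.prod_insert nE₂, Finset.prod_insert i3,
    Finset.prod_insert i4, Finset.prod_insert i5, Finset.prod_insert i6, Finset.prod_insert i7, Finset.prod_insert nM₂]
  rw [zE₁, zM₁, zM₂, zE₂]
  push_cast
  -- the offsets `j_Q ≥ 1`
  set joff : ι → ℕ := fun Q => (if z Q < c then c - z Q else z Q - c - 3).toNat with hjoff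
  have hj : ∀ Q ∈ Ext, 1 ≤ joff Q ∧
      ((z Q < c ∧ (z Q : ℝ) = c - joff Q) ∨ (c + 3 < z Q ∧ (z Q : ℝ) = c + 3 + joff Q)) := by
    intro Q hQ
    rcases hout Q hQ with h | h
    · have e : (joff Q : ℤ) = c - z Q := by simp only [hjoff, if_pos h]; omega
      refine ⟨by omega, Or.inl ⟨h, ?_⟩⟩
      have e' : ((joff Q : ℤ) : ℝ) = (c : ℝ) - z Q := by exact_mod_cast e
      push_cast at e'; linarith
    · have hn : ¬ z Q < c := by omega
      have e : (joff Q : ℤ) = z Q - c - 3 := by simp only [hjoff, if_neg hn]; omega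
      refine ⟨by omega, Or.inr ⟨h, ?_⟩⟩
      have e' : ((joff Q : ℤ) : ℝ) = (z Q : ℝ) - c - 3 := by exact_mod_cast e
      push_cast at e'; linarith
  -- external factors in terms of the offsets
  have fE₁ : ∀ Q ∈ Ext, |(c : ℝ) - z Q| * |(c : ℝ) + 3 - z Q| = (joff Q : ℝ) * ((joff Q : ℝ) + 3) := by
    intro Q hQ
    obtain ⟨hj1, h⟩ := hj Q hQ
    have hj0 : (0 : ℝ) ≤ joff Q := by positivity
    rcases h with ⟨_, e⟩ | ⟨_, e⟩ <;> rw [e]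
    · rw [show (c : ℝ) - (c - joff Q) = joff Q by ring, show (c : ℝ) + 3 - (c - joff Q) = joff Q + 3 by ring,
        abs_of_nonneg hj0, abs_of_nonneg (by linarith)]
    · rw [show (c : ℝ) - (c + 3 + joff Q) = -(joff Q + 3) by ring, show (c : ℝ) + 3 - (c + 3 + joff Q) = -(joff Q) by ring,
        abs_neg, abs_neg, abs_of_nonneg hj0, abs_of_nonneg (by linarith), mul_comm]
  have fM : ∀ Q ∈ Ext, |(c : ℝ) + 1 - z Q| * |(c : ℝ) + 2 - z Q| = ((joff Q : ℝ) + 1) * ((joff Q : ℝ) + 2) := by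
    intro Q hQ
    obtain ⟨hj1, h⟩ := hj Q hQ
    have hj0 : (0 : ℝ) ≤ joff Q := by positivity
    rcases h with ⟨_, e⟩ | ⟨_, e⟩ <;> rw [e]
    · rw [show (c : ℝ) + 1 - (c - joff Q) = joff Q + 1 by ring, show (c : ℝ) + 2 - (c - joff Q) = joff Q + 2 by ring,
        abs_of_nonneg (by linarith), abs_of_nonneg (by linarith)]
    · rw [show (c : ℝ) + 1 - (c + 3 + joff Q) = -(joff Q + 2) by ring, show (c : ℝ) + 2 - (c + 3 + joff Q) = -(joff Q + 1) by ring,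
        abs_neg, abs_neg, abs_of_nonneg (by linarith), abs_of_nonneg (by linarith), mul_comm]
  -- regroup:  LHS = 4 · ∏_Ext (j+1)(j+2),  RHS = 36 · ∏_Ext j(j+3)
  have hL : (|(c : ℝ) + 1 - c| * (|(c : ℝ) + 1 - (c + 2)| * (|(c : ℝ) + 1 - (c + 3)| * ∏ Q ∈ Ext, |(c : ℝ) + 1 - z Q|))) *
      (|(c : ℝ) + 2 - c| * (|(c : ℝ) + 2 - (c + 1)| * (|(c : ℝ) + 2 - (c + 3)| * ∏ Q ∈ Ext, |(c : ℝ) + 2 - z Q|))) =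
      4 * ∏ Q ∈ Ext, ((joff Q : ℝ) + 1) * ((joff Q : ℝ) + 2) := by
    rw [← Finset.prod_congr rfl fM, Finset.prod_mul_distrib]
    norm_num; ring
  have hR : (|(c : ℝ) - (c + 1)| * (|(c : ℝ) - (c + 2)| * (|(c : ℝ) - (c + 3)| * ∏ Q ∈ Ext, |(c : ℝ) - z Q|))) *
      (|(c : ℝ) + 3 - c| * (|(c : ℝ) + 3 - (c + 1)| * (|(c : ℝ) + 3 - (c + 2)| * ∏ Q ∈ Ext, |(c : ℝ) + 3 - z Q|))) =
      36 * ∏ Q ∈ Ext, ((joff Q : ℝ) * ((joff Q : ℝ) + 3)) := by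
    rw [← Finset.prod_congr rfl fE₁, Finset.prod_mul_distrib]
    norm_num; ring
  rw [hL, hR]
  -- split the externals into the two sides; offsets are injective on each side
  set ExtL := Ext.filter (fun Q => z Q < c) with hExtL
  set ExtR := Ext.filter (fun Q => ¬ z Q < c) with hExtR
  have hsplit : ∀ g : ι → ℝ, ∏ Q ∈ Ext, g Q = (∏ Q ∈ ExtL, g Q) * ∏ Q ∈ ExtR, g Q := fun g =>
    (Finset.prod_filter_mul_prod_filter_not Ext (fun Q => z Q < c) g).symm
  have hinjL : Set.InjOn joff ExtL := by
    intro Q hQ Q' hQ' h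
    have hQm := Finset.mem_filter.mp (Finset.mem_coe.mp hQ)
    have hQ'm := Finset.mem_filter.mp (Finset.mem_coe.mp hQ')
    have e1 : (joff Q : ℤ) = c - z Q := by simp only [hjoff, if_pos hQm.2]; omega
    have e2 : (joff Q' : ℤ) = c - z Q' := by simp only [hjoff, if_pos hQ'm.2]; omega
    have hz : (joff Q : ℤ) = (joff Q' : ℤ) := by rw [h]
    exact hinj Q ((hExt_mem Q).mp hQm.1).1 Q' ((hExt_mem Q').mp hQ'm.1).1 (by omega)
  have hinjR : Set.InjOn joff ExtR := by
    intro Q hQ Q' hQ' h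
    have hQm := Finset.mem_filter.mp (Finset.mem_coe.mp hQ)
    have hQ'm := Finset.mem_filter.mp (Finset.mem_coe.mp hQ')
    have e1 : (joff Q : ℤ) = z Q - c - 3 := by
      simp only [hjoff, if_neg hQm.2]; have := hout Q hQm.1; omega
    have e2 : (joff Q' : ℤ) = z Q' - c - 3 := by
      simp only [hjoff, if_neg hQ'm.2]; have := hout Q' hQ'm.1; omega
    have hz : (joff Q : ℤ) = (joff Q' : ℤ) := by rw [h]
    exact hinj Q ((hExt_mem Q).mp hQm.1).1 Q' ((hExt_mem Q').mp hQ'm.1).1 (by omega)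
  have hposL : ∀ j ∈ ExtL.image joff, 1 ≤ j := by
    intro j hjm; obtain ⟨Q, hQ, rfl⟩ := Finset.mem_image.mp hjm; exact (hj Q (Finset.mem_filter.mp hQ).1).1
  have hposR : ∀ j ∈ ExtR.image joff, 1 ≤ j := by
    intro j hjm; obtain ⟨Q, hQ, rfl⟩ := Finset.mem_image.mp hjm; exact (hj Q (Finset.mem_filter.mp hQ).1).1
  have hL' := prod_ratio_lt_three (ExtL.image joff) hposL
  have hR' := prod_ratio_lt_three (ExtR.image joff) hposR
  rw [Finset.prod_image hinjL, Finset.prod_image hinjL] at hL'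
  rw [Finset.prod_image hinjR, Finset.prod_image hinjR] at hR'
  rw [hsplit (fun Q => ((joff Q : ℝ) + 1) * ((joff Q : ℝ) + 2)), hsplit (fun Q => (joff Q : ℝ) * ((joff Q : ℝ) + 3))]
  have hpL : 0 < ∏ Q ∈ ExtL, ((joff Q : ℝ) * ((joff Q : ℝ) + 3)) :=
    Finset.prod_pos fun Q hQ => mul_pos (by exact_mod_cast (hj Q (Finset.mem_filter.mp hQ).1).1) (by positivity)
  have hpR : 0 < ∏ Q ∈ ExtR, ((joff Q : ℝ) * ((joff Q : ℝ) + 3)) :=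
    Finset.prod_pos fun Q hQ => mul_pos (by exact_mod_cast (hj Q (Finset.mem_filter.mp hQ).1).1) (by positivity)
  have hnL : 0 ≤ ∏ Q ∈ ExtL, (((joff Q : ℝ) + 1) * ((joff Q : ℝ) + 2)) := Finset.prod_nonneg fun Q _ => by positivity
  nlinarith [mul_lt_mul'' hL' hR' hnL (Finset.prod_nonneg fun Q _ => by positivity)]

end EdgeNormalForm

end Summit.ValiantsHypothesis.ValiantsHypothesis.Theorems.KPlusLogSqLaw
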